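import Summits.BirchSwinnertonDyer.BirchSwinnertonDyer.Theses.SmallImageMuTransfer
import Summits.BirchSwinnertonDyer.BirchSwinnertonDyer.Theorems.Rank1ResidualX9MuTransfer
import Literature.NumberTheory.EllipticCurves.EmertonPollackWeston2006.MuAnTransferGoodOrdinary
import Literature.NumberTheory.EllipticCurves.GreenbergVatsal2000.CongruentCurves
import Literature.NumberTheory.EllipticCurves.ComplexMultiplication
import Literature.NumberTheory.EllipticCurves.ModularCurvePeriodRatio
import Literature.NumberTheory.EllipticCurves.CuspFormLFunctionLevelConductorProofs
import HarnessLib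

/-!
# Route `SmallImageMuTransfer` (K6), crux `AnalyticMuZeroX9` (stmt-BirchSwinnertonDyer-19630), line `d1_byname`:
# the split D1 needs ONE published input beyond the route's own bundle — Carayol is discharged by modularity

Lead seat `bsd-line-k6-p1` (helper `--supports stmt-BirchSwinnertonDyer-19630`; it closes no stub and no item).

The registered line `d1_byname` (skeleton b2a7244df4b8880f) is the K6 route's glued split D1 of the crux,
`AnalyticMuZeroX9 ⟸ MuZeroCMCurves (item 19234) ∧ AnalyticMuZeroX9NoCMPartner (item 19235) ∧ MuSplitInputs (item 19236)`,
whose glue is the proved seam `Rank1Residual.analyticMuZeroOnClassX9_of_cmSplit` (p418273).  The third child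
`MuSplitInputs` is the cite-only conjunction of THREE named published facts: EPW 2006 Thm 1 (analytic half,
`EmertonPollackWeston2006.thm1_muAn_transfer_of_torsionIso`), the period unit A25
(`realPeriodRat_eq_unit_mul_plusPeriod`), and Carayol's level theorem at every level
(`IsNewformOf.level_eq_conductorNorm`).  This file records, in the kernel, that the seam consumes Carayol only
at the X9 member `W` itself (a globally minimal curve) and only to pin the level of the given newform `f` of
`W` to `N_W`; there it is a CONSEQUENCE of modularity in the tree's parametrisation form
(`nonempty_modularParametrizationData`: a newform of `W` at level `N_W` exists) by strong multiplicity one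
across levels, a theorem of the tree (`IsNewformOf.level_eq_conductorNorm_of_exists_conductorLevel`,
`CuspFormLFunctionLevelConductorProofs`).  Since A25 and `nonempty_modularParametrizationData` are conjuncts 3
and 6 of the route's own published-inputs bundle `PublishedInputsX9` (item 19632, the named facts the K6
assembly `bsdpOnClassX9_of_katoMuTransfer` already consumes), the split D1 adds exactly ONE published input
to the route: EPW 2006 Thm 1.

* `analyticMuZeroOnClassX9_of_cmSplit_of_levelOnClassX9` — the seam with its Carayol conjunct weakened to
  «level = conductor for the newforms of X9 members» (proof = the seam's, p418273, with that one line changed).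
* `levelOnClassX9_of_modularParametrizationData` — that weakened conjunct from `nonempty_modularParametrizationData`.
* `analyticMuZeroOnClassX9_of_cmSplit_of_modularParametrizationData` — D1 with inputs EPW ∧ A25 ∧ modularity.
* `analyticMuZeroX9_of_children_of_epw_of_publishedInputsX9` — BY NAME on the route:
  `MuZeroCMCurves → AnalyticMuZeroX9NoCMPartner → EPW Thm 1 → PublishedInputsX9 → AnalyticMuZeroX9`.

HONEST FRAMING: conditional compositions only; both child cruxes 19234 / 19235 stay OPEN (Greenberg's Conj. 1.11,
analytic `ω⁰`-branch, on infinite classes) and EPW Thm 1 / A25 / modularity stay named facts.  Nothing about any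
curve is asserted; class X9 stays TYPED; BSD is not proved by any of this.

References: [EmertonPollackWeston2006] Thm. 1; [GreenbergVatsal2000] Rem. 3.4; [Carayol1986];
[AtkinLehner1970] Thm. 4 (strong multiplicity one across levels); [BreuilConradDiamondTaylor2001] Thm. A.
-/

-- the summit and its single problem are both named `BirchSwinnertonDyer` (registry layout D-0017)
set_option linter.dupNamespace false

set_option autoImplicit false

noncomputable section

open scoped Classical MatrixGroups ModularForm

open CongruenceSubgroup WeierstrassCurve Literature.NumberTheory.EllipticCurves
  Literature.NumberTheory.EllipticCurves.ModularForms
  Literature.NumberTheory.EllipticCurves.GreenbergVatsal2000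

namespace Summit.BirchSwinnertonDyer.BirchSwinnertonDyer.Rank1Residual

/-- **The D1 seam with Carayol weakened to the X9 members.**  Hypotheses: `h1` = `MuZeroCMCurves` (item
19234, OPEN), `h2` = `AnalyticMuZeroX9NoCMPartner` (item 19235, OPEN), `hEPW` = EPW 2006 Thm 1 (analytic half),
`hA25` = the period unit at irreducible `p ≥ 5`, and `hlev` = «for every X9 pair `(W, p)` and every newform `f` of
`W` at any level `N`, `N = N_W`» (the only use the seam p418273 makes of Carayol's theorem).  Conclusion: the
crux's signature `AnalyticMuZeroOnClassX9`.  Proof: verbatim the seam's (by cases on a good-ordinary CM partner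
`A` with `A[p] ≃ W[p]`; EPW transport of the `ϖ`-normalised unit coefficient; `‖u⁻¹‖ = 1` drops `ϖ`), with
`hlev` in place of Carayol.  CONDITIONAL composition — credits nothing toward closure.
[cite: EmertonPollackWeston2006, Thm. 1 (arXiv:math/0404484 p. 2)] [cite: GreenbergVatsal2000, Rem. 3.4] -/
theorem analyticMuZeroOnClassX9_of_cmSplit_of_levelOnClassX9
    (h1 : ∀ (A : WeierstrassCurve ℚ) [A.IsElliptic] [A.IsGloballyMinimal] (p : ℕ) [Fact p.Prime],
      5 ≤ p → A.j ∈ Literature.NumberTheory.EllipticCurves.maximalCMJInvariants →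
      A.HasGoodReductionAtPrime p → ¬ (p : ℤ) ∣ A.frobeniusTrace p →
      A.HasIrreducibleModPGaloisRep p →
      ∀ [NeZero (A.conductorNorm ℤ)]
        (fA : CuspForm (CongruenceSubgroup.Gamma0 (A.conductorNorm ℤ)) 2),
        Literature.NumberTheory.EllipticCurves.ModularForms.IsNewformOf A fA → ∀ (ϖ : ℚ),
        (ϖ : ℝ) * A.realPeriodRat = Literature.NumberTheory.EllipticCurves.ModularForms.plusPeriod fA →
        ∃ n : ℕ, ‖PowerSeries.coeff n (PowerSeries.C (ϖ : ℚ_[p]) *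
          Literature.NumberTheory.EllipticCurves.padicLFunction fA
            (Literature.NumberTheory.EllipticCurves.unitRoot A p : ℚ_[p]))‖ = 1)
    (h2 : ∀ (W : WeierstrassCurve ℚ) [W.IsElliptic] [W.IsGloballyMinimal] (p : ℕ) [Fact p.Prime]
      {N : ℕ} [NeZero N] (f : CuspForm (CongruenceSubgroup.Gamma0 N) 2),
      Summit.BirchSwinnertonDyer.BirchSwinnertonDyer.Rank1Residual.ClassX9 W p →
      ¬ (∃ (A : WeierstrassCurve ℚ) (_ : A.IsElliptic) (_ : A.IsGloballyMinimal),
          A.j ∈ Literature.NumberTheory.EllipticCurves.maximalCMJInvariants ∧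
          A.HasGoodReductionAtPrime p ∧ ¬ (p : ℤ) ∣ A.frobeniusTrace p ∧
          ∃ e : WeierstrassCurve.geomTorsion A (p : ℤ) ≃+ WeierstrassCurve.geomTorsion W (p : ℤ),
            ∀ (σ : Field.absoluteGaloisGroup ℚ) (P : WeierstrassCurve.geomTorsion A (p : ℤ)),
              e (σ • P) = σ • e P) →
      Literature.NumberTheory.EllipticCurves.ModularForms.IsNewformOf W f →
      ∃ n : ℕ, ‖PowerSeries.coeff n (Literature.NumberTheory.EllipticCurves.padicLFunction f
        (Literature.NumberTheory.EllipticCurves.unitRoot W p : ℚ_[p]))‖ = 1)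
    (hEPW : Literature.NumberTheory.EllipticCurves.EmertonPollackWeston2006.thm1_muAn_transfer_of_torsionIso)
    (hA25 : Literature.NumberTheory.EllipticCurves.realPeriodRat_eq_unit_mul_plusPeriod)
    (hlev : ∀ (W : WeierstrassCurve ℚ) [W.IsElliptic] [W.IsGloballyMinimal] (p : ℕ) [Fact p.Prime]
      {N : ℕ} [NeZero N] (f : CuspForm (CongruenceSubgroup.Gamma0 N) 2),
      Summit.BirchSwinnertonDyer.BirchSwinnertonDyer.Rank1Residual.ClassX9 W p →
      Literature.NumberTheory.EllipticCurves.ModularForms.IsNewformOf W f → N = W.conductorNorm ℤ) :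
    AnalyticMuZeroOnClassX9 := by
  -- adapted from `analyticMuZeroOnClassX9_of_cmSplit` (p418273): the single line `hCar N hf` is replaced by `hlev`
  unfold AnalyticMuZeroOnClassX9
  intro W _ _ p _ N _ f hX9 hf
  by_cases hP : ∃ (A : WeierstrassCurve ℚ) (_ : A.IsElliptic) (_ : A.IsGloballyMinimal),
      A.j ∈ Literature.NumberTheory.EllipticCurves.maximalCMJInvariants ∧
      A.HasGoodReductionAtPrime p ∧ ¬ (p : ℤ) ∣ A.frobeniusTrace p ∧
      ∃ e : WeierstrassCurve.geomTorsion A (p : ℤ) ≃+ WeierstrassCurve.geomTorsion W (p : ℤ),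
        ∀ (σ : Field.absoluteGaloisGroup ℚ) (P : WeierstrassCurve.geomTorsion A (p : ℤ)),
          e (σ • P) = σ • e P
  · -- the level of `f` is the conductor of the X9 member `W`
    have hN : N = W.conductorNorm ℤ := hlev W p f hX9 hf
    obtain ⟨A, hAE, hAM, hjA, hgoodA, hordA, e, he⟩ := hP
    obtain ⟨-, h5, hgood, hord, hirr, -⟩ := hX9
    -- the inverse isomorphism is equivariant as well
    have he' : ∀ (σ : Field.absoluteGaloisGroup ℚ) (Q : geomTorsion W (p : ℤ)),
        e.symm (σ • Q) = σ • e.symm Q := by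
      intro σ Q
      apply e.injective
      rw [e.apply_symm_apply, he, e.apply_symm_apply]
    have hirrA : A.HasIrreducibleModPGaloisRep p :=
      hasIrreducibleModPGaloisRep_of_torsionIso e.symm he' hirr
    subst hN
    -- the period unit for `W`
    obtain ⟨u, hu, hΩ⟩ := hA25 W p h5 hgood hirr f hf
    have hu0 : (u : ℚ_[p]) ≠ 0 := by
      intro h0
      rw [h0, norm_zero] at hu
      exact zero_ne_one hu
    have hu0' : u ≠ 0 := by
      intro h0
      exact hu0 (by rw [h0]; push_cast; rfl)
    have hϖ : ((u⁻¹ : ℚ) : ℝ) * W.realPeriodRat = plusPeriod f := by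
      rw [hΩ]
      push_cast
      rw [← mul_assoc, inv_mul_cancel₀ (by exact_mod_cast hu0'), one_mul]
    -- D1a at the partner, in the shape EPW consumes
    have hμA : ∀ [NeZero (A.conductorNorm ℤ)] (fA : CuspForm (Gamma0 (A.conductorNorm ℤ)) 2),
        IsNewformOf A fA → ∀ (ϖ : ℚ), (ϖ : ℝ) * A.realPeriodRat = plusPeriod fA →
        ∃ n : ℕ, ‖PowerSeries.coeff n
          (PowerSeries.C (ϖ : ℚ_[p]) * padicLFunction fA (unitRoot A p : ℚ_[p]))‖ = 1 := by
      intro _ fA hfA ϖ hϖA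
      exact h1 A p h5 hjA hgoodA hordA hirrA fA hfA ϖ hϖA
    obtain ⟨n, hn⟩ :=
      hEPW A W p h5 hgoodA hordA hgood hord ⟨e, he⟩ hirrA hμA f hf (u⁻¹ : ℚ) hϖ
    refine ⟨n, ?_⟩
    have hnorm : ‖((u⁻¹ : ℚ) : ℚ_[p])‖ = 1 := by
      push_cast
      rw [norm_inv, hu, inv_one]
    rw [PowerSeries.coeff_C_mul, norm_mul, hnorm, one_mul] at hn
    exact hn
  · exact h2 W p f hX9 hP hf

/-- **Level `=` conductor for the newforms of globally minimal curves, from modularity as parametrisation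
data.**  `nonempty_modularParametrizationData` (Breuil–Conrad–Diamond–Taylor 2001 Thm A in the tree's form:
for every globally minimal elliptic `W` a `ModularParametrizationData W N_W`, whose field `f` is a newform of
`W` at level `N_W`) gives, for ANY newform `f` of such a `W` at any level `N`, `N = N_W` — strong multiplicity
one across levels (Atkin–Lehner 1970 Thm 4), a theorem of the tree
(`IsNewformOf.level_eq_conductorNorm_of_exists_conductorLevel`).  In particular the hypothesis `hlev` of
`analyticMuZeroOnClassX9_of_cmSplit_of_levelOnClassX9` (the `ClassX9` binder is not even used).
[cite: AtkinLehner1970, Thm. 4] [cite: BreuilConradDiamondTaylor2001, Thm. A] -/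
theorem levelOnClassX9_of_modularParametrizationData
    (hmodP : Literature.NumberTheory.EllipticCurves.ModularForms.nonempty_modularParametrizationData) :
    ∀ (W : WeierstrassCurve ℚ) [W.IsElliptic] [W.IsGloballyMinimal] (p : ℕ) [Fact p.Prime]
      {N : ℕ} [NeZero N] (f : CuspForm (CongruenceSubgroup.Gamma0 N) 2),
      Summit.BirchSwinnertonDyer.BirchSwinnertonDyer.Rank1Residual.ClassX9 W p →
      Literature.NumberTheory.EllipticCurves.ModularForms.IsNewformOf W f → N = W.conductorNorm ℤ := by
  intro W _ _ p _ N _ f _ hf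
  haveI : NeZero (W.conductorNorm ℤ) := ⟨(W.conductorNorm_pos_holds).ne'⟩
  obtain ⟨D⟩ := hmodP W
  exact IsNewformOf.level_eq_conductorNorm_of_exists_conductorLevel ⟨D.f, D.isNewformOf⟩ hf

/-- **D1 with inputs EPW ∧ A25 ∧ modularity (no Carayol).**  The crux's signature `AnalyticMuZeroOnClassX9`
from the two child cruxes (items 19234, 19235 — OPEN) and the named facts EPW 2006 Thm 1 (analytic half), the
period unit A25, and modularity as parametrisation data.  CONDITIONAL composition — credits nothing toward
closure. [cite: EmertonPollackWeston2006, Thm. 1 (arXiv:math/0404484 p. 2)] [cite: GreenbergVatsal2000, Rem. 3.4] -/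
theorem analyticMuZeroOnClassX9_of_cmSplit_of_modularParametrizationData
    (h1 : Summit.BirchSwinnertonDyer.BirchSwinnertonDyer.Theses.SmallImageMuTransfer.MuZeroCMCurves)
    (h2 : Summit.BirchSwinnertonDyer.BirchSwinnertonDyer.Theses.SmallImageMuTransfer.AnalyticMuZeroX9NoCMPartner)
    (hEPW : Literature.NumberTheory.EllipticCurves.EmertonPollackWeston2006.thm1_muAn_transfer_of_torsionIso)
    (hA25 : Literature.NumberTheory.EllipticCurves.realPeriodRat_eq_unit_mul_plusPeriod)
    (hmodP : Literature.NumberTheory.EllipticCurves.ModularForms.nonempty_modularParametrizationData) :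
    AnalyticMuZeroOnClassX9 :=
  analyticMuZeroOnClassX9_of_cmSplit_of_levelOnClassX9 h1 h2 hEPW hA25
    (levelOnClassX9_of_modularParametrizationData hmodP)

end Summit.BirchSwinnertonDyer.BirchSwinnertonDyer.Rank1Residual


namespace Summit.BirchSwinnertonDyer.BirchSwinnertonDyer.Theorems

open Summit.BirchSwinnertonDyer.BirchSwinnertonDyer.Theses.SmallImageMuTransfer

/-- **BY NAME on route `SmallImageMuTransfer`: the split D1 costs the route ONE published input, EPW 2006
Thm 1.**  `MuZeroCMCurves → AnalyticMuZeroX9NoCMPartner → EPW Thm 1 → PublishedInputsX9 → AnalyticMuZeroX9`: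
the period unit A25 and modularity (parametrisation data) are conjuncts 3 and 6 of the route's own bundle
`PublishedInputsX9` (item 19632, consumed by the K6 assembly already), and they discharge the other two
conjuncts of `MuSplitInputs` as far as the seam uses them.  CONDITIONAL composition (both child cruxes OPEN,
every named fact a hypothesis) — credits nothing toward closure; BSD is not proved by this.
[cite: EmertonPollackWeston2006, Thm. 1 (arXiv:math/0404484 p. 2)] [cite: GreenbergVatsal2000, Rem. 3.4] -/
theorem analyticMuZeroX9_of_children_of_epw_of_publishedInputsX9
    (h1 : MuZeroCMCurves) (h2 : AnalyticMuZeroX9NoCMPartner)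
    (hEPW : Literature.NumberTheory.EllipticCurves.EmertonPollackWeston2006.thm1_muAn_transfer_of_torsionIso)
    (hPub : PublishedInputsX9) : AnalyticMuZeroX9 := by
  obtain ⟨-, -, hA25, -, -, hmodP, -, -⟩ := hPub
  exact Summit.BirchSwinnertonDyer.BirchSwinnertonDyer.Rank1Residual.analyticMuZeroOnClassX9_of_cmSplit_of_modularParametrizationData
    h1 h2 hEPW hA25 hmodP

end Summit.BirchSwinnertonDyer.BirchSwinnertonDyer.Theorems

end
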